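import Summits.HodgeConjecture.HodgeConjecture.Theorems.CyclicUnitaryPowersColourProjectors
import Literature.AlgebraicGeometry.Motives.MumfordTateInvariantsBaseChange
import Mathlib.RingTheory.Polynomial.Cyclotomic.Roots

/-!
# Rationality: the coloured support of a rational tensor and the eigenblock dimensions do not depend on the
# primitive root (Galois stability along `ζ ↦ ζ^u`)

Helper for stub T `stub_unitaryTorusLemma` of the crux `PowersHodgeOfDeckCommutators` (stmt-HodgeConjecture-19545,
route `CyclicUnitaryPowers`, line `unitary-kunneth-fft` v6, lane 2).  For a rational endomorphism `s` of a
finite-dimensional `ℚ`-space `V` and the spectral / colour projectors of `s_ℂ` built from a primitive `p`-th root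
(`CyclicUnitaryPowersSpectralProjectors`, `CyclicUnitaryPowersColourProjectors`):

* §1 two primitive `p`-th roots `ξ, ξ'` have the same minimal polynomial `Φ_p` over `ℚ`, so a rational polynomial
  vanishing at `ξ` vanishes at `ξ'`; hence a combination `Σ_i q_i ξ^{e_i} (1 ⊗ m_i)` of RATIONAL vectors with
  cyclotomic coefficients vanishes iff the same combination with `ξ'` does (`sum_smul_one_tmul_eq_zero_of_isPrimitiveRoot`,
  and its transport `…_tensorSpaceToBaseChange_…` to `T^{a,b}_ℂ V_ℂ` along the comparison isomorphism);
* §2 slot operators commute with the comparison map `ι : T^{r,0} V → T^{r,0}_ℂ V_ℂ`, and the colour projector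
  `⊗_l P^ξ_{c l}` applied to `ι t` is such a cyclotomic combination of the rational tensors `ι ((⊗_l s^{κ l}) t)`;
* §3 **`P^ξ_c (ι t) = 0 ↔ P^{ξ'}_c (ι t) = 0`** and, since `P^{ζ^u}_c = P^ζ_{u c}`, **the coloured support
  `{c : P_c (ι t) ≠ 0}` of a rational tensor is stable under `c ↦ u • c`** (`u` prime to `p`);
* §4 **the eigenblocks `E_j = range P_j`, `j` prime to `p`, all have the same dimension** (the trace of `P^ξ_j` is a
  rational polynomial in `ξ`).

Pure linear algebra (Serre, *Linear Representations of Finite Groups*, §12.1: rationality questions); no Hodge theory.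
-/

noncomputable section

open Module Polynomial
open scoped TensorProduct PiTensorProduct BigOperators

namespace Summit.HodgeConjecture.HodgeConjecture.Theorems.CyclicUnitaryPowersPrimitiveRootTransfer

open Literature.AlgebraicGeometry.Motives
open Summit.HodgeConjecture.HodgeConjecture.Theorems.CyclicUnitaryPowersSpectralProjectors
open Summit.HodgeConjecture.HodgeConjecture.Theorems.CyclicUnitaryPowersColourProjectors

/-! ### §1 Cyclotomic combinations of rational vectors -/

/-- **A rational polynomial vanishing at one primitive `p`-th root vanishes at every other** (`Φ_p` is the common
minimal polynomial). [folklore] -/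
theorem aeval_eq_zero_of_isPrimitiveRoot {p : ℕ} (hp : 0 < p) {ξ ξ' : ℂ} (hξ : IsPrimitiveRoot ξ p)
    (hξ' : IsPrimitiveRoot ξ' p) {f : ℚ[X]} (h : aeval ξ f = 0) : aeval ξ' f = 0 := by
  rw [← minpoly.dvd_iff, ← cyclotomic_eq_minpoly_rat hξ' hp, cyclotomic_eq_minpoly_rat hξ hp, minpoly.dvd_iff]
  exact h

/-- **Galois stability of the vanishing of a cyclotomic combination of rational vectors** in `ℂ ⊗_ℚ M`:
`Σ_i q_i ξ^{e_i} (1 ⊗ m_i) = 0` for one primitive `p`-th root `ξ` implies the same for any other primitive `p`-th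
root `ξ'` (coordinates in `1 ⊗ b` for a `ℚ`-basis `b` of `M` are rational polynomials in `ξ`). [folklore] -/
theorem sum_smul_one_tmul_eq_zero_of_isPrimitiveRoot {M : Type*} [AddCommGroup M] [Module ℚ M] {I : Type*}
    (S : Finset I) (q : I → ℚ) (e : I → ℕ) (m : I → M) {p : ℕ} (hp : 0 < p) {ξ ξ' : ℂ}
    (hξ : IsPrimitiveRoot ξ p) (hξ' : IsPrimitiveRoot ξ' p)
    (h : ∑ i ∈ S, (algebraMap ℚ ℂ (q i) * ξ ^ e i) • ((1 : ℂ) ⊗ₜ[ℚ] m i) = 0) :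
    ∑ i ∈ S, (algebraMap ℚ ℂ (q i) * ξ' ^ e i) • ((1 : ℂ) ⊗ₜ[ℚ] m i) = 0 := by
  classical
  let b := Module.Free.chooseBasis ℚ M
  let B := Algebra.TensorProduct.basis ℂ b
  have hcoord : ∀ (θ : ℂ) (k : Module.Free.ChooseBasisIndex ℚ M),
      B.repr (∑ i ∈ S, (algebraMap ℚ ℂ (q i) * θ ^ e i) • ((1 : ℂ) ⊗ₜ[ℚ] m i)) k =
        aeval θ (∑ i ∈ S, C (q i * b.repr (m i) k) * X ^ e i) := by
    intro θ k
    simp only [map_sum, map_smul, Finsupp.coe_finsetSum, Finsupp.coe_smul, Finset.sum_apply, Pi.smul_apply,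
      smul_eq_mul, map_mul, aeval_C, map_pow, aeval_X]
    refine Finset.sum_congr rfl fun i _ => ?_
    rw [Algebra.TensorProduct.basis_repr_tmul, one_smul, Finsupp.mapRange_apply]
    ring
  rw [← B.forall_coord_eq_zero_iff] at h ⊢
  intro k
  have hk := h k
  rw [Basis.coord_apply, hcoord] at hk ⊢
  exact aeval_eq_zero_of_isPrimitiveRoot hp hξ hξ' hk

/-- The same in the complexified tensor space `T^{a,b}_ℂ V_ℂ`, for rational tensors `ι (m i)`
(`ι = tensorSpaceToBaseChange ℂ V a b`, transported along the comparison isomorphism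
`hodgeTensorSpaceBaseChange`). [folklore] -/
theorem sum_smul_tensorSpaceToBaseChange_eq_zero_of_isPrimitiveRoot {V : Type*} [AddCommGroup V] [Module ℚ V]
    [Module.Finite ℚ V] {a b : ℕ} {I : Type*} (S : Finset I) (q : I → ℚ) (e : I → ℕ)
    (m : I → hodgeTensorSpace V a b) {p : ℕ} (hp : 0 < p) {ξ ξ' : ℂ} (hξ : IsPrimitiveRoot ξ p)
    (hξ' : IsPrimitiveRoot ξ' p)
    (h : ∑ i ∈ S, (algebraMap ℚ ℂ (q i) * ξ ^ e i) • tensorSpaceToBaseChange ℂ V a b (m i) = 0) :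
    ∑ i ∈ S, (algebraMap ℚ ℂ (q i) * ξ' ^ e i) • tensorSpaceToBaseChange ℂ V a b (m i) = 0 := by
  have key : ∀ θ : ℂ, ∑ i ∈ S, (algebraMap ℚ ℂ (q i) * θ ^ e i) • tensorSpaceToBaseChange ℂ V a b (m i) =
      hodgeTensorSpaceBaseChange V a b (∑ i ∈ S, (algebraMap ℚ ℂ (q i) * θ ^ e i) • ((1 : ℂ) ⊗ₜ[ℚ] m i)) := by
    intro θ
    rw [map_sum]
    refine Finset.sum_congr rfl fun i _ => ?_
    rw [map_smul, hodgeTensorSpaceBaseChange_one_tmul]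
  rw [key] at h ⊢
  rw [LinearEquiv.map_eq_zero_iff] at h ⊢
  exact sum_smul_one_tmul_eq_zero_of_isPrimitiveRoot S q e m hp hξ hξ' h

/-! ### §2 Slot operators and the comparison map; the colour projector of a rational tensor -/

section Slot

variable (K : Type*) [Field K] [Algebra ℚ K] {V : Type*} [AddCommGroup V] [Module ℚ V] {r : ℕ}

/-- **Slot operators commute with the comparison map**: `(⊗_l (f l)_K) (ι t) = ι ((⊗_l f l) t)`. [folklore] -/
theorem slotMap_baseChange_tensorSpaceToBaseChange (f : Fin r → Module.End ℚ V) (t : hodgeTensorSpace V r 0) :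
    slotMap (fun l => (f l).baseChange K) (tensorSpaceToBaseChange K V r 0 t) =
      tensorSpaceToBaseChange K V r 0 (slotMap f t) := by
  suffices h : ((slotMap (fun l => (f l).baseChange K)).restrictScalars ℚ) ∘ₗ tensorSpaceToBaseChange K V r 0 =
      tensorSpaceToBaseChange K V r 0 ∘ₗ slotMap f from LinearMap.congr_fun h t
  ext v φ
  simp only [LinearMap.compMultilinearMap_apply, TensorProduct.AlgebraTensorModule.curry_apply, LinearMap.coe_comp,
    Function.comp_apply, LinearMap.coe_restrictScalars, TensorProduct.curry_apply,
    tensorSpaceToBaseChange_tprod_tmul_tprod, slotMap_tprod_tmul, LinearMap.baseChange_tmul]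

end Slot

section Colour

variable {V : Type*} [AddCommGroup V] [Module ℚ V] (s : V →ₗ[ℚ] V) {p : ℕ} {r : ℕ}

/-- The spectral projector with natural exponents: `P^ξ_j = Σ_{i<p} (p⁻¹ ξ^{i (p-1) j}) σⁱ`. [folklore] -/
theorem specProj_eq_sum_pow {K : Type*} [Field K] {W : Type*} [AddCommGroup W] [Module K W] (σ : W →ₗ[K] W)
    {ξ : K} (hξ : IsPrimitiveRoot ξ p) (hp : 0 < p) (j : ℕ) :
    specProj σ ξ p j = ∑ i ∈ Finset.range p, ((p : K)⁻¹ * ξ ^ (i * ((p - 1) * j))) • σ ^ i := by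
  rw [specProj_def, Finset.smul_sum]
  refine Finset.sum_congr rfl fun i _ => ?_
  rw [smul_smul, inv_pow_mul_eq hξ hp]

/-- **The colour projector of a rational tensor is a cyclotomic combination of rational tensors**:
`P^ξ_c (ι t) = Σ_κ (p^{-r} ξ^{Σ_l κ_l (p-1) c_l}) • ι ((⊗_l s^{κ l}) t)`. [folklore] -/
theorem colourProj_tensorSpaceToBaseChange_eq_sum {ξ : ℂ} (hξ : IsPrimitiveRoot ξ p) (hp : 0 < p) (c : Fin r → ℕ)
    (t : hodgeTensorSpace V r 0) :
    colourProj (s.baseChange ℂ) ξ p c (tensorSpaceToBaseChange ℂ V r 0 t) =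
      ∑ κ ∈ Fintype.piFinset (fun _ : Fin r => Finset.range p),
        (algebraMap ℚ ℂ (((p : ℚ)⁻¹) ^ r) * ξ ^ (∑ l, κ l * ((p - 1) * c l))) •
          tensorSpaceToBaseChange ℂ V r 0 (slotMap (fun l => s ^ κ l) t) := by
  rw [colourProj_def]
  have hP : (fun l : Fin r => specProj (s.baseChange ℂ) ξ p (c l)) =
      fun l => ∑ i ∈ Finset.range p, ((p : ℂ)⁻¹ * ξ ^ (i * ((p - 1) * c l))) • (s ^ i).baseChange ℂ := by
    funext l
    rw [specProj_eq_sum_pow _ hξ hp]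
    simp_rw [LinearMap.baseChange_pow]
  rw [hP, slotMap_sum, LinearMap.sum_apply]
  refine Finset.sum_congr rfl fun κ _ => ?_
  rw [slotMap_smul, LinearMap.smul_apply, slotMap_baseChange_tensorSpaceToBaseChange ℂ (fun l => s ^ κ l) t,
    Finset.prod_mul_distrib, Finset.prod_const, Finset.card_univ, Fintype.card_fin, Finset.prod_pow_eq_pow_sum,
    map_pow, map_inv₀, map_natCast]

/-! ### §3 The coloured support of a rational tensor is independent of the primitive root -/

/-- **`P^ξ_c (ι t) = 0 → P^{ξ'}_c (ι t) = 0`** for primitive `p`-th roots `ξ, ξ'` and a rational tensor `t`. [folklore] -/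
theorem colourProj_tensorSpaceToBaseChange_eq_zero_of_isPrimitiveRoot [Module.Finite ℚ V] (hp : 0 < p) {ξ ξ' : ℂ}
    (hξ : IsPrimitiveRoot ξ p) (hξ' : IsPrimitiveRoot ξ' p) (c : Fin r → ℕ) (t : hodgeTensorSpace V r 0)
    (h : colourProj (s.baseChange ℂ) ξ p c (tensorSpaceToBaseChange ℂ V r 0 t) = 0) :
    colourProj (s.baseChange ℂ) ξ' p c (tensorSpaceToBaseChange ℂ V r 0 t) = 0 := by
  rw [colourProj_tensorSpaceToBaseChange_eq_sum s hξ' hp]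
  rw [colourProj_tensorSpaceToBaseChange_eq_sum s hξ hp] at h
  have h2 := sum_smul_tensorSpaceToBaseChange_eq_zero_of_isPrimitiveRoot
    (Fintype.piFinset fun _ : Fin r => Finset.range p) (fun _ => ((p : ℚ)⁻¹) ^ r)
    (fun κ : Fin r → ℕ => ∑ l, κ l * ((p - 1) * c l)) (fun κ => slotMap (fun l => s ^ κ l) t) hp hξ hξ'
    (by simpa only using h)
  simpa only using h2

/-- `P^ξ_c (ι t) = 0 ↔ P^{ξ'}_c (ι t) = 0`. [folklore] -/
theorem colourProj_tensorSpaceToBaseChange_eq_zero_iff [Module.Finite ℚ V] (hp : 0 < p) {ξ ξ' : ℂ}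
    (hξ : IsPrimitiveRoot ξ p) (hξ' : IsPrimitiveRoot ξ' p) (c : Fin r → ℕ) (t : hodgeTensorSpace V r 0) :
    colourProj (s.baseChange ℂ) ξ p c (tensorSpaceToBaseChange ℂ V r 0 t) = 0 ↔
      colourProj (s.baseChange ℂ) ξ' p c (tensorSpaceToBaseChange ℂ V r 0 t) = 0 :=
  ⟨colourProj_tensorSpaceToBaseChange_eq_zero_of_isPrimitiveRoot s hp hξ hξ' c t,
    colourProj_tensorSpaceToBaseChange_eq_zero_of_isPrimitiveRoot s hp hξ' hξ c t⟩

/-- Changing the primitive root `ζ ↦ ζ^u` relabels the spectral projectors: `P^{ζ^u}_j = P^ζ_{u j}`. [folklore] -/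
theorem specProj_pow_eq {K : Type*} [Field K] {W : Type*} [AddCommGroup W] [Module K W] (σ : W →ₗ[K] W) (ζ : K)
    (p u j : ℕ) : specProj σ (ζ ^ u) p j = specProj σ ζ p (u * j) := by
  rw [specProj_def, specProj_def]
  refine congrArg _ (Finset.sum_congr rfl fun i _ => ?_)
  rw [← pow_mul, show u * (i * j) = i * (u * j) by ring]

/-- The spectral projectors only depend on the index modulo `p`. [folklore] -/
theorem specProj_mod_eq {K : Type*} [Field K] {W : Type*} [AddCommGroup W] [Module K W] (σ : W →ₗ[K] W) {ζ : K}
    (hζ : IsPrimitiveRoot ζ p) (j : ℕ) : specProj σ ζ p (j % p) = specProj σ ζ p j := by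
  rw [specProj_def, specProj_def]
  refine congrArg _ (Finset.sum_congr rfl fun i _ => ?_)
  have hmod : i * (j % p) % p = i * j % p := by
    conv_rhs => rw [Nat.mul_mod]
    rw [Nat.mul_mod, Nat.mod_mod]
  rw [pow_eq_pow_mod (i * (j % p)) hζ.pow_eq_one, pow_eq_pow_mod (i * j) hζ.pow_eq_one, hmod]

/-- `P^{ζ^u}_c = P^ζ_{(u c) mod p}` on colourings. [folklore] -/
theorem colourProj_pow_eq {K : Type*} [Field K] {W : Type*} [AddCommGroup W] [Module K W] {r : ℕ} (σ : W →ₗ[K] W)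
    {ζ : K} (hζ : IsPrimitiveRoot ζ p) (u : ℕ) (c : Fin r → ℕ) :
    colourProj (r := r) σ (ζ ^ u) p c = colourProj σ ζ p (fun l => (u * c l) % p) := by
  rw [colourProj_def, colourProj_def]
  congr 1
  funext l
  rw [specProj_pow_eq, specProj_mod_eq σ hζ]

/-- **The coloured support of a rational tensor is Galois-stable**: for `u` prime to `p`,
`P_c (ι t) = 0 ↔ P_{(u c) mod p} (ι t) = 0`. [folklore] -/
theorem colourProj_tensorSpaceToBaseChange_eq_zero_iff_mul [Module.Finite ℚ V] (hp : 0 < p) {ζ : ℂ}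
    (hζ : IsPrimitiveRoot ζ p) {u : ℕ} (hu : u.Coprime p) (c : Fin r → ℕ) (t : hodgeTensorSpace V r 0) :
    colourProj (s.baseChange ℂ) ζ p c (tensorSpaceToBaseChange ℂ V r 0 t) = 0 ↔
      colourProj (s.baseChange ℂ) ζ p (fun l => (u * c l) % p) (tensorSpaceToBaseChange ℂ V r 0 t) = 0 := by
  rw [← colourProj_pow_eq _ hζ, colourProj_tensorSpaceToBaseChange_eq_zero_iff s hp hζ (hζ.pow_of_coprime u hu) c t]

end Colour

/-! ### §4 The eigenblocks `E_j`, `j` prime to `p`, have the same dimension -/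

section Dimension

variable {V : Type*} [AddCommGroup V] [Module ℚ V] [Module.Finite ℚ V] (s : V →ₗ[ℚ] V) {p : ℕ}

/-- The trace of an idempotent is the dimension of its range. [folklore] -/
theorem trace_eq_finrank_range_of_isIdempotentElem {P : Module.End ℂ (ℂ ⊗[ℚ] V)} (hP : IsIdempotentElem P) :
    LinearMap.trace ℂ _ P = (Module.finrank ℂ ↥(LinearMap.range P) : ℂ) := by
  have hproj : LinearMap.IsProj (LinearMap.range P) P :=
    ⟨fun x => LinearMap.mem_range_self P x, fun x hx => by
      obtain ⟨y, rfl⟩ := hx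
      rw [← Module.End.mul_apply, hP.eq]⟩
  exact hproj.trace

/-- **The trace of `P^ξ_j` is a rational polynomial in `ξ`**: `tr P^ξ_j = Σ_{i<p} p⁻¹ tr(sⁱ) ξ^{i (p-1) j}`. [folklore] -/
theorem trace_specProj_eq_aeval {ξ : ℂ} (hξ : IsPrimitiveRoot ξ p) (hp : 0 < p) (j : ℕ) :
    LinearMap.trace ℂ _ (specProj (s.baseChange ℂ) ξ p j) =
      aeval ξ (∑ i ∈ Finset.range p, C ((p : ℚ)⁻¹ * LinearMap.trace ℚ V (s ^ i)) * X ^ (i * ((p - 1) * j))) := by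
  rw [specProj_eq_sum_pow _ hξ hp, map_sum, map_sum]
  refine Finset.sum_congr rfl fun i _ => ?_
  rw [map_smul, ← LinearMap.baseChange_pow, LinearMap.trace_baseChange, map_mul (aeval ξ), aeval_C, aeval_X_pow,
    smul_eq_mul, map_mul (algebraMap ℚ ℂ), map_inv₀, map_natCast]
  ring

/-- **All eigenblocks `E_j = range P_j` with `j` prime to `p` have the same dimension** as `E_1`: `P^ζ_j = P^{ζ^j}_1`
and the rational polynomial `tr P^X_1 - dim E_1` vanishes at `ζ`, hence at `ζ^j`. [folklore] -/
theorem finrank_range_specProj_eq (hsp : s.baseChange ℂ ^ p = 1) {ζ : ℂ} (hζ : IsPrimitiveRoot ζ p) (hp : 0 < p)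
    {j : ℕ} (hj : j.Coprime p) :
    Module.finrank ℂ ↥(LinearMap.range (specProj (s.baseChange ℂ) ζ p j)) =
      Module.finrank ℂ ↥(LinearMap.range (specProj (s.baseChange ℂ) ζ p 1)) := by
  have hζj : IsPrimitiveRoot (ζ ^ j) p := hζ.pow_of_coprime j hj
  have hrel : specProj (s.baseChange ℂ) ζ p j = specProj (s.baseChange ℂ) (ζ ^ j) p 1 := by
    rw [specProj_pow_eq, mul_one]
  set F : ℚ[X] := ∑ i ∈ Finset.range p, C ((p : ℚ)⁻¹ * LinearMap.trace ℚ V (s ^ i)) * X ^ (i * ((p - 1) * 1)) with hF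
  set n₁ := Module.finrank ℂ ↥(LinearMap.range (specProj (s.baseChange ℂ) ζ p 1)) with hn₁
  have h1 : aeval ζ (F - C (n₁ : ℚ)) = 0 := by
    rw [map_sub, aeval_C, map_natCast, ← trace_specProj_eq_aeval s hζ hp 1,
      trace_eq_finrank_range_of_isIdempotentElem (isIdempotentElem_specProj hsp hζ hp 1), sub_self]
  have h2 := aeval_eq_zero_of_isPrimitiveRoot hp hζ hζj h1
  rw [map_sub, aeval_C, map_natCast, ← trace_specProj_eq_aeval s hζj hp 1,
    trace_eq_finrank_range_of_isIdempotentElem (isIdempotentElem_specProj hsp hζj hp 1), sub_eq_zero, ← hrel] at h2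
  exact_mod_cast h2

end Dimension

end Summit.HodgeConjecture.HodgeConjecture.Theorems.CyclicUnitaryPowersPrimitiveRootTransfer

end
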